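import Literature.Probability.Percolation.LoopRotationInvarianceProofs
import Literature.Probability.LatticeModels.IsoradialPercolationProofs
import HarnessLib

/-!
# Interface loops of critical percolation on the isoradial rectangular lattices `L(α)` (DKKMO)

Third layer of the decomposition of the named fact `dkkmo_rotation_invariance`
(`Literature.Probability.Percolation.LoopRotationInvariance`, **crit-perc.S25**): the objects and
the universality theorem (Theorem 1.7) of Duminil-Copin–Kozlowski–Krachun–Manolescu–Oulamara,
*Rotational invariance in critical planar lattice models*, arXiv:2012.11672 (v2, 2026), §1.4,
specialised to `q = 1` (Bernoulli percolation), from which the paper's Theorem 1.2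
(= crit-perc.S25) follows by the reflection argument of its Remark 1.8 / §4.

## Contents (namespace `Literature.CritPerc`)

* `isoRectLinear α : ℂ →L[ℝ] ℂ` : the real-linear map carrying `ℤ² = ℤ[i]` onto DKKMO's lattice
  `L(α)` ("the embedding of `ℤ²` in which horizontal edges have length `2 cos(α/2)` and vertical
  edges have length `2 sin(α/2)`, rotated by an angle `α/2`", §1.4): `1 ↦ 2cos(α/2) e^{iα/2}`,
  `i ↦ 2 sin(α/2) i e^{iα/2}`. At `α = π/2` it is `z ↦ √2 e^{iπ/4} z`
  (`isoRectLinear_pi_div_two`; "`L(π/2)` is `ℤ²` rotated by `π/4` and dilated by `√2`").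
* `isoRectPoint δ α`, `isoRectMedialPoint δ α` : vertices and edge midpoints of `δ L(α)`.
* `IsHorizontal e` : the pair `e = {x, y}` has `x₁ = y₁` (horizontal edges of `ℤ²`).
* `isoRectWeight α e`, `isoRectPercolation α` : DKKMO's inhomogeneous critical weights at `q = 1`,
  `p_hor / (1 - p_hor) = (1 - p_vert) / p_vert = sin(α/3) / sin((π - α)/3)` (§1.4 with
  `r = π⁻¹ cos⁻¹(√q / 2) = 1/3`), i.e. `p_hor = criticalWeight (α/2)`, `p_vert = criticalWeight
  ((π - α)/2)` in terms of the prelude's Grimmett–Manolescu weight, and the product measure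
  `φ_{L(α)}` (the prelude's `prodBernoulli`; at `q = 1` the infinite-volume measure is a product
  measure). `isoRectPercolation_pi_div_two`: `φ_{L(π/2)}` is `bondPercolation (zdGraph 2) half`.
* `isoRectLoopCurve δ α γ`, `isoRectLoopCollection δ α Λ ω` : the interface loops of `ω` drawn
  on `δ L(α)` (same combinatorial loops `IsInterfaceLoop ω γ` as on `ℤ²`, polylines through the
  `L(α)`-midpoints), and their collection inside a window `Λ`, a point of `LoopSpace ℂ` — the
  exact analogues of `loopCurve`, `bondLoopCollection` of the S25 file, to which they reduce at
  `α = π/2` up to the similarity `z ↦ √2 e^{iπ/4} z` (`isoRectLoopCollection_pi_div_two`).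
* Named fact (tree conventions of crit-perc.S25: based oriented loop classes, every dart as a
  base point, hard centred window `closedBall 0 R`, Hausdorff edistance on `LoopSpace ℂ`, and
  DKKMO's coupling form of `d_CN` on laws, §1.2):
  `dkkmo_universality_coupling` — Theorem 1.7 (`q = 1`): `φ_{δL(α)}` and `φ_{δL(π/2)}` couple
  with loop collections `C δ^c`-close off a set of mass `C δ^c`, uniformly in `α ∈ (0, π)`.
  Theorem 1.9 (`q = 1`; universality up to linear deformation: the same for `φ_{δL(β)}` and the
  image under `M⁻¹` of `φ_{δL(α)}` for *some* invertible real-linear `M = M_{β,α}`, constants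
  depending on `α, β`) is, as printed, existential in `M` and "a weaker version of Theorem 1.7"
  (§1.4); it is not a separate named fact but a proved corollary of `dkkmo_universality_coupling`
  (`dkkmo_linearDeformation_coupling_of_universality`, `dkkmo_universality_coupling.pairwise` in
  `IsoradialRectangularLoopsProofs`, with `M = id`).

## Where this sits in the DKKMO proof (v2)

Theorem 1.9, for the explicit drift matrix `M_{β,α}` of §3 (built from the lateral and vertical
IIC drifts; continuous in the angles, Lemma 3.2), is §3 (track exchanges, IIC increments,
martingale drift; the deepest part); Theorem 1.7 = Theorem 1.9 + "`M_{π/2,α} = id`" (§4.2: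
Lemma 4.4, Proposition 3.12, uniformity §3.9/Proposition 3.13), which itself uses the
qualitative rotational invariance of §4.1 (Propositions 4.1, 4.2 and the reflection-group
argument, run on the explicit `M_{β,α}`). Theorem 1.2 with constants uniform in
the angle then follows from Theorem 1.7 by Remark 1.8: `e^{iα/2}ℝ` is a symmetry axis of `L(α)`,
so `φ_{L(π/2)}` is `C δ^c`-invariant under that reflection, and two reflections compose to a
rotation. That last step is elementary given this file and is the next layer
(Lévy–Prokhorov triangle inequality, exact lattice symmetries, isometry invariance).

## References

* H. Duminil-Copin, K. K. Kozlowski, D. Krachun, I. Manolescu, M. Oulamara, arXiv:2012.11672v2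
  (2026): §1.4 (lattices `L(α)`, weights, Theorems 1.7 and 1.9, Remark 1.8), eq. (2).
* G. R. Grimmett, I. Manolescu, *Bond percolation on isoradial graphs: criticality and
  universality*, PTRF 159 (2014), (1.3)/(2.1) (the canonical weight `criticalWeight`).
* G. Grimmett, *Percolation*, 2nd ed. (1999), §1.3 (product measures), §11.2 (medial lattice).
-/

noncomputable section

open MeasureTheory Set Complex
open scoped ENNReal Real

namespace Literature.Probability.Percolation

open LatticeModels

/-! ### The isoradial rectangular lattice `L(α)` -/

/-- The real-linear map of `ℂ` carrying `ℤ² = ℤ[i]` onto DKKMO's isoradial rectangular lattice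
`L(α)`: `z = x + iy ↦ e^{iα/2} (2 cos(α/2) x + 2 sin(α/2) y i)`, so that horizontal edges of `ℤ²`
get length `2 cos(α/2)`, vertical ones `2 sin(α/2)`, and the picture is rotated by `α/2`
(every face is then a rhombus inscribed in a unit-radius circle: an isoradial embedding).
(DKKMO, arXiv:2012.11672v2, §1.4.) [cite: arXiv201211672v2, §1.4] -/
def isoRectLinear (α : ℝ) : ℂ →L[ℝ] ℂ :=
  reCLM.smulRight (((2 * Real.cos (α / 2) : ℝ) : ℂ) * exp (((α / 2 : ℝ) : ℂ) * I)) +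
    imCLM.smulRight (((2 * Real.sin (α / 2) : ℝ) : ℂ) * I * exp (((α / 2 : ℝ) : ℂ) * I))

/-- `isoRectLinear α` in coordinates. (DKKMO, arXiv:2012.11672v2, §1.4.) [cite: arXiv201211672v2, §1.4] -/
theorem isoRectLinear_apply (α : ℝ) (z : ℂ) :
    isoRectLinear α z = exp (((α / 2 : ℝ) : ℂ) * I) *
      ((2 * Real.cos (α / 2) : ℝ) * (z.re : ℂ) + (2 * Real.sin (α / 2) : ℝ) * (z.im : ℂ) * I) := by
  simp only [isoRectLinear, add_apply, ContinuousLinearMap.smulRight_apply,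
    reCLM_apply, imCLM_apply, Complex.real_smul]
  ring

/-- "`L(π/2)` is the square lattice rotated by `π/4` and dilated by `√2`":
`isoRectLinear (π/2) z = e^{iπ/4} (√2 z)`. (DKKMO, arXiv:2012.11672v2, §1.4.) [cite: arXiv201211672v2, §1.4] -/
theorem isoRectLinear_pi_div_two (z : ℂ) :
    isoRectLinear (π / 2) z = rotation (Circle.exp (π / 4)) ((Real.sqrt 2 : ℂ) * z) := by
  rw [isoRectLinear_apply, rotation_apply, Circle.coe_exp]
  have h4 : π / 2 / 2 = π / 4 := by ring
  rw [h4, Real.cos_pi_div_four, Real.sin_pi_div_four]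
  have h2 : (2 * (Real.sqrt 2 / 2) : ℝ) = Real.sqrt 2 := by ring
  rw [h2]
  conv_rhs => rw [← re_add_im z]
  push_cast
  ring

/-- The vertex of `δ L(α)` corresponding to the site `x ∈ ℤ²`: `isoRectLinear α (δ x)`.
(DKKMO, arXiv:2012.11672v2, §1.4.) [cite: arXiv201211672v2, §1.4] -/
def isoRectPoint (δ α : ℝ) (x : Site 2) : ℂ := isoRectLinear α (meshPoint δ x)

/-- The point of the plane attached to the medial vertex (edge) `e` of `δ L(α)`: the image under
`isoRectLinear α` of the `δℤ²` midpoint, i.e. the midpoint of the embedded edge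
(`isoRectMedialPoint_mk`), which is the centre of its rhombus. (DKKMO, arXiv:2012.11672v2,
§1.4 and §2.1 (diamond graph).) [cite: arXiv201211672v2, §1.4] -/
def isoRectMedialPoint (δ α : ℝ) (e : MedialVertex) : ℂ := isoRectLinear α (medialPoint δ e)

/-- The medial point of `{x, y}` on `δ L(α)` is the midpoint of the embedded edge.
(DKKMO, arXiv:2012.11672v2, §2.1.) [cite: arXiv201211672v2, §2.1] -/
theorem isoRectMedialPoint_mk (δ α : ℝ) (x y : Site 2) :
    isoRectMedialPoint δ α s(x, y) = (isoRectPoint δ α x + isoRectPoint δ α y) / 2 := by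
  simp only [isoRectMedialPoint, isoRectPoint, medialPoint_mk]
  have h2 : (meshPoint δ x + meshPoint δ y) / 2 = (2⁻¹ : ℝ) • (meshPoint δ x + meshPoint δ y) := by
    rw [Complex.real_smul]; push_cast; ring
  rw [h2, map_smul, map_add, Complex.real_smul]
  push_cast
  ring

/-- A pair `{x, y}` of sites is *horizontal* if `x` and `y` have the same second coordinate
(for an edge of `ℤ²`: it is a horizontal edge, embedded in `L(α)` with length `2 cos(α/2)`;
otherwise a vertical edge, of length `2 sin(α/2)`). (DKKMO, arXiv:2012.11672v2, §1.4.) [cite: arXiv201211672v2, §1.4] -/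
def IsHorizontal : Sym2 (Site 2) → Prop :=
  Sym2.lift ⟨fun x y => x 1 = y 1, fun _ _ => propext eq_comm⟩

/-- `IsHorizontal` on an explicit pair. (DKKMO, arXiv:2012.11672v2, §1.4.) [cite: arXiv201211672v2, §1.4] -/
@[simp] theorem isHorizontal_mk (x y : Site 2) : IsHorizontal s(x, y) ↔ x 1 = y 1 := Iff.rfl

open scoped Classical in
/-- DKKMO's edge weights of the critical model on `L(α)` at `q = 1` (§1.4 with
`r = π⁻¹ cos⁻¹(√q/2) = 1/3`): `p_hor / (1 - p_hor) = (1 - p_vert) / p_vert = sin(α/3) / sin((π - α)/3)`,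
i.e. `p_hor = criticalWeight (α/2) = sin(α/3) / (sin(α/3) + sin((π-α)/3))` on horizontal edges and
`p_vert = criticalWeight ((π - α)/2) = 1 - p_hor` on vertical edges of `ℤ²` (the Grimmett–Manolescu
canonical weights of the rhombi of `L(α)`, half-angles `α/2` and `(π - α)/2`); non-edges get `0`.
At `α = π/2` both weights are `1/2` (`isoRectWeight_pi_div_two`). (DKKMO, arXiv:2012.11672v2,
§1.4; Grimmett–Manolescu 2014, (1.3).) [cite: arXiv201211672v2, §1.4] -/
def isoRectWeight (α : ℝ) (e : Sym2 (Site 2)) : unitInterval :=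
  if e ∈ (zdGraph 2).edgeSet then
    (if IsHorizontal e then criticalWeightI (α / 2) else criticalWeightI ((π - α) / 2))
  else 0

open scoped Classical in
/-- At `α = π/2` every edge of `ℤ²` has weight `1/2`. (DKKMO, arXiv:2012.11672v2, §1.4:
"`φ_{L(π/2)}` is the critical random-cluster measure on `ℤ²`".) [cite: arXiv201211672v2, §1.4] -/
theorem isoRectWeight_pi_div_two (e : Sym2 (Site 2)) :
    isoRectWeight (π / 2) e = if e ∈ (zdGraph 2).edgeSet then half else 0 := by
  unfold isoRectWeight
  have h1 : π / 2 / 2 = π / 4 := by ring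
  have h2 : (π - π / 2) / 2 = π / 4 := by ring
  rw [h1, h2, criticalWeightI_pi_div_four, ite_self]

/-- The critical percolation measure `φ_{L(α)}` on the isoradial rectangular lattice at `q = 1`:
independent edges with the inhomogeneous weights `isoRectWeight α` (the prelude's
`prodBernoulli`). At `q = 1` DKKMO's "unique infinite-volume measure" is this product measure.
Configurations are subsets of `Sym2 (Site 2)`, as for `bondPercolation (zdGraph 2) p`; the
embedding `L(α)` only enters through the loops. (DKKMO, arXiv:2012.11672v2, §1.4.) [cite: arXiv201211672v2, §1.4] -/
def isoRectPercolation (α : ℝ) : Measure (BondConfig (Site 2)) :=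
  prodBernoulli (isoRectWeight α)

/-- `isoRectPercolation α` is a probability measure. (DKKMO, arXiv:2012.11672v2, §1.4.) [cite: arXiv201211672v2, §1.4] -/
instance instIsProbabilityMeasureIsoRectPercolation (α : ℝ) :
    IsProbabilityMeasure (isoRectPercolation α) := by
  unfold isoRectPercolation; infer_instance

/-- `φ_{L(π/2)}` is critical bond percolation on `ℤ²`: `isoRectPercolation (π/2) =
bondPercolation (zdGraph 2) half`. (DKKMO, arXiv:2012.11672v2, §1.4.) [cite: arXiv201211672v2, §1.4] -/
theorem isoRectPercolation_pi_div_two :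
    isoRectPercolation (π / 2) = bondPercolation (zdGraph 2) half := by
  classical
  unfold isoRectPercolation bondPercolation
  rw [← prodBernoulli_indicator_holds ((zdGraph 2).edgeSet) half]
  congr 1
  funext e
  rw [isoRectWeight_pi_div_two]

/-! ### Interface loops drawn on `δ L(α)` -/

/-- The closed polyline traced on `δ L(α)` by the list of medial vertices `γ`: the polyline
through the `L(α)`-midpoints `isoRectMedialPoint δ α e` of the entries `e` of `γ`, returning to
its first point, modulo reparametrisation — the analogue on `L(α)` of `loopCurve δ α γ` (which
draws the same combinatorial loop on the rotated square lattice `δ e^{iα} ℤ²`).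
(DKKMO, arXiv:2012.11672v2, §1.2 and §2.3: loop representation on the medial/diamond graph.) [cite: arXiv201211672v2, §2.3] -/
def isoRectLoopCurve (δ α : ℝ) (γ : List MedialVertex) : RandomPlanarGeometry.CurveClass ℂ :=
  RandomPlanarGeometry.CurveClass.mk ⟨polyline ((γ ++ γ.take 1).map (isoRectMedialPoint δ α))⟩

/-- The loop drawn on `δ L(α)` is the image under `isoRectLinear α` of the loop drawn on `δℤ²`:
`isoRectLoopCurve δ α γ = (loopCurve δ 0 γ).map (isoRectLinear α)`.
(DKKMO, arXiv:2012.11672v2, §1.4.) [cite: arXiv201211672v2, §1.4] -/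
theorem isoRectLoopCurve_eq_map (δ α : ℝ) (γ : List MedialVertex) :
    isoRectLoopCurve δ α γ =
      (loopCurve δ 0 γ).map ⟨isoRectLinear α, (isoRectLinear α).continuous⟩ := by
  simp only [isoRectLoopCurve, loopCurve, RandomPlanarGeometry.CurveClass.map_mk]
  congr 1
  ext t
  change polyline _ t = isoRectLinear α (polyline _ t)
  rw [apply_polyline (isoRectLinear α) (map_zero _)
    (fun x y c => by simp only [AffineMap.lineMap_apply_module, map_add, map_smul]), List.map_map]
  congr 2
  refine List.map_congr_left fun e _ => ?_
  simp [isoRectMedialPoint, Circle.exp_zero]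

/-- `isoRectLoopCurve δ α γ` is a loop for nonempty `γ`. (DKKMO, arXiv:2012.11672v2, §2.3.) [cite: arXiv201211672v2, §2.3] -/
theorem isLoop_isoRectLoopCurve (δ α : ℝ) {γ : List MedialVertex} (hγ : γ ≠ []) :
    (isoRectLoopCurve δ α γ).IsLoop := by
  rw [isoRectLoopCurve_eq_map]
  exact (isLoop_loopCurve δ 0 hγ).map _

/-- Medial points scale linearly with the mesh. (Grimmett 1999, §11.2.) [folklore] -/
theorem medialPoint_mul (a δ : ℝ) (e : MedialVertex) :
    medialPoint (a * δ) e = (a : ℂ) * medialPoint δ e := by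
  induction e using Sym2.ind with
  | h x y => simp only [medialPoint_mk, meshPoint]; push_cast; ring

/-- At `α = π/2` the `L(α)`-loop is the loop of the square lattice of mesh `√2 δ` rotated by
`π/4`: `isoRectLoopCurve δ (π/2) γ = loopCurve (√2 δ) (π/4) γ`.
(DKKMO, arXiv:2012.11672v2, §1.4.) [cite: arXiv201211672v2, §1.4] -/
theorem isoRectLoopCurve_pi_div_two (δ : ℝ) (γ : List MedialVertex) :
    isoRectLoopCurve δ (π / 2) γ = loopCurve (Real.sqrt 2 * δ) (π / 4) γ := by
  simp only [isoRectLoopCurve, loopCurve]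
  congr 3
  refine List.map_congr_left fun e _ => ?_
  rw [isoRectMedialPoint, isoRectLinear_pi_div_two, medialPoint_mul]

/-- The collection of interface loops of the configuration `ω` drawn on `δ L(α)` inside the window
`Λ`: the closure (vacuous for bounded `Λ`, `δ > 0`, `α ∈ (0, π)`) of the set of classes
`isoRectLoopCurve δ α γ` of the interface loops `γ` of `ω` (`IsInterfaceLoop ω γ`, the
combinatorial cluster-boundary loops of `ℤ²`, which `L(α)` shares) whose trace lies in `Λ`, as a
point of `LoopSpace ℂ` — the analogue on `L(α)` of `bondLoopCollection δ α Λ ω`; same conventions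
(every dart as base point, loops oriented with the primal cluster on the left).
(DKKMO, arXiv:2012.11672v2, §1.2, §2.3.) [cite: arXiv201211672v2, §2.3] -/
def isoRectLoopCollection (δ α : ℝ) (Λ : Set ℂ) (ω : BondConfig (Site 2)) : RandomPlanarGeometry.LoopSpace ℂ :=
  ⟨closure (isoRectLoopCurve δ α ''
      {γ | IsInterfaceLoop ω γ ∧ (isoRectLoopCurve δ α γ).range ⊆ Λ}), isClosed_closure⟩

/-- At `α = π/2` the `L(α)`-loop collection is the loop collection of crit-perc.S25 on the
square lattice of mesh `√2 δ` rotated by `π/4`: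
`isoRectLoopCollection δ (π/2) Λ ω = bondLoopCollection (√2 δ) (π/4) Λ ω`.
(DKKMO, arXiv:2012.11672v2, §1.4.) [cite: arXiv201211672v2, §1.4] -/
theorem isoRectLoopCollection_pi_div_two (δ : ℝ) (Λ : Set ℂ) (ω : BondConfig (Site 2)) :
    isoRectLoopCollection δ (π / 2) Λ ω = bondLoopCollection (Real.sqrt 2 * δ) (π / 4) Λ ω := by
  have h : isoRectLoopCurve δ (π / 2) = loopCurve (Real.sqrt 2 * δ) (π / 4) :=
    funext (isoRectLoopCurve_pi_div_two δ)
  simp only [isoRectLoopCollection, bondLoopCollection, h]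

/-! ### DKKMO's universality theorem at `q = 1` (named fact) -/

/-- **DKKMO Theorem 1.7 at `q = 1` (asymptotic universality for isoradial rectangular lattices),
coupling form in the conventions of crit-perc.S25.** There are constants `C`, `c > 0` (depending
on the window radius `R` only) such that for every angle `α ∈ (0, π)` and mesh `δ ∈ (0, 1]` the
critical percolation configurations `ω ∼ φ_{L(α)}` and `ω' ∼ φ_{L(π/2)}` can be coupled — a
measure on pairs of bond configurations with marginals `isoRectPercolation α` and
`isoRectPercolation (π/2)` — so that the Hausdorff edistance between the collections of interface
loops of `ω` drawn on `δL(α)` and of `ω'` drawn on `δL(π/2)`, inside `closedBall 0 R`, exceeds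
`C δ^c` (strictly, the event of eq. (2): `P[d_CN(ω, ω') > ε] < ε`) with probability at most
`C δ^c`. Printed form: `d_CN(φ_{δL(α)}, φ_{δL(π/2)}) < C δ^c`
for every `α ∈ (0, π)` and `δ > 0`, `q ∈ [1, 4]`, with `d_CN` on laws the coupling distance
(eq. (2)) of the Camia–Newman metric (unbased, unoriented loops, window `B(0, 1/ε)`); here
rendered, exactly as crit-perc.S25 renders Theorem 1.2, with based oriented loop classes (every
dart a base point), the hard centred window and the Hausdorff edistance of `LoopSpace ℂ`; the
`d_SS` half and `q ≠ 1` are omitted. Caveat on faithfulness: this rendering is the project's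
convention for DKKMO-type statements (crit-perc.S25), not literally the printed one: the
printed `d_CN` compares unbased loops typed as exterior boundaries of primal / dual clusters
(`F = F₀ ⊔ F₁`, matched within each type — which pins the orientation of every loop of inradius
`> ε`) inside the soft window `B(0, 1/ε)`; passing to based oriented classes with every dart a
base point and to the hard window `closedBall 0 R` requires the routine extra estimates
recorded in the literature-prover notes (boundary three-arm events, thin loops, density of
microscopic loops). Proved in the source from Theorem 1.9 (universality up to the explicit
linear deformation `M_{β,α}` of §3) and the identification `M_{π/2,α} = id` (§4.2, Lemma 4.4,
Propositions 3.12–3.13).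
(DKKMO, arXiv:2012.11672v2 (2026), Theorem 1.7, eq. (2).) [cite: arXiv201211672v2, Thm 1.7] -/
def dkkmo_universality_coupling : Prop :=
  ∀ (R : ℝ),
    ∃ C c : ℝ, 0 < c ∧ ∀ α ∈ Set.Ioo (0 : ℝ) π, ∀ δ ∈ Set.Ioc (0 : ℝ) 1,
      ∃ P : Measure (BondConfig (Site 2) × BondConfig (Site 2)),
        P.map Prod.fst = isoRectPercolation α ∧
        P.map Prod.snd = isoRectPercolation (π / 2) ∧
        P {p | ENNReal.ofReal (C * δ ^ c) <
            edist (isoRectLoopCollection δ α (Metric.closedBall 0 R) p.1)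
              (isoRectLoopCollection δ (π / 2) (Metric.closedBall 0 R) p.2)} ≤
          ENNReal.ofReal (C * δ ^ c)

end Literature.Probability.Percolation

end
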